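import Summits.QuantumFields.BalabanUV.Beta.FP.FineHessianNearLedger
import Summits.QuantumFields.BalabanUV.Beta.FP.FineSplitJunctionLedgerGen

/-!
# `BalabanUV.Beta.FP.FineHessianNearLedgerGen` — road «FP» for binder row D1, ROW KER-γ, RULING R-FP-40 (A) rows «E-COLS»∕«3B-GEN = G4» (assigned to the leaf-01
# lineage CLAIMS 2026-08-21 l.28874 (c), precision l.28901): THE (LEDGER) SKELETON END WITH EVERYTHING ROAD-SPECIFIC ABSTRACT — the road OWNER's PART 3b
# `FineHessianNearLedger.hasym_PiBF_vertex2OfK_of_sliceLedger` with the coarse tables `T m`, the fine tables `F m` (`hslice`∕`hfar`∕`hnearSplit` stated on `F m`;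
# sandwich `hsand` and boundedness `hFb` DISPLAYED), the END columns `colOf (Kp m)`∕`colH (Kp m) (Lc^m)` with (L0)(L1)(LE)(LS), and the reflection letter `hKcov`
# (R-FP-39) ALL ABSTRACT — so the SAME theorem serves the axial road (`T m := TPerfOf …`), the LEFT placement of record for the literal
# (`T m := hessKer (KPerf m) (vertexOfK (KPerf m) (Lc^m) (S^s_m)) (vertex2OfK (KPerf m) (Lc^m) (Wf^s_m))`, `hsand` by `GenericResolventSandwich.hessKer_self_eq_dressedEntryP`)
# and any other placement with a packed block-covariant column kernel

HONEST DEPENDENCY (page 1, mandatory): continuum YM on T⁴ ⇐ BetaPertH ∧ nine spine estimates (0/9 proved); BetaPertH ⇐ (D1) ∧ (D4) ∧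
CAP+tail; G-an2-4 gates asym, D1 and NE2/3/4.  HONEST FRAMING (cell contract, verbatim): «discharging `BetaPertH` makes Bałaban's UV
stability UNCONDITIONAL — a real constructive-QFT result; it is NOT the continuum limit and NOT the Clay problem.»  THIS MODULE is [our object]
COMPOSITION BY NAME: the owner's END body verbatim (scripted substitution from the TREE text of PART 3b: `fineHessA (axDressK …) (coProj …) (Wf m)` ↦ `F m`,
`colH (KPerf…m) (Lc^m)` ↦ `colH (Kp m) (Lc^m)`, `TPerfOf …` ↦ `T m`, the `hS`∕`hWf` jet letters replaced by the column letters + `hsand`∕`hFb`, the one call re-pointed to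
`FineSplitJunctionLedgerGen.hasym_PiBF_of_far_nearPieces_gen`); authorship of the mathematics = the road owner (PART 3b).  No `def`, no `def … : Prop`, nothing cited,
nothing of the manuscripts under audit asserted, 0 sorry; no existing file touched.  NOT the instances (next file `RoadAsympEndLeft`), NOT (LEDGER) lines, NOT hsplit,
NOT (ASYMP) for the literal, NOT D1; 0∕4 row-D1 binders; NOT BetaPertH, NOT continuum, NOT Clay.

ABSOLUTE RULE (cell charter, verbatim): «No internally-minted statement may enter as a cited fact. Every hypothesis is either kernel-proved in this
package or a verbatim quotation of a PUBLISHED theorem with page reference. The manuscript(s) under audit are NOT citable for their own disputed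
steps — they are the thing under adjudication; programme-internal (2001/route/tribunal) claims are never citable.»

CONTENT ([our object]): **`hasym_PiBF_of_sliceLedger_gen`**.
Provenance: D1 formalisation swarm LEAF PROVER 01, unit `b2b-balaban-beta-d1-formalise-leaf-01` gen 12, 2026-08-21, road FP rows E-COLS∕3B-GEN (R-FP-40 (A)).
-/

noncomputable section

namespace Summit.QuantumFields.BalabanUV.Beta.FP.FineHessianNearLedgerGen

open Finset
open scoped BigOperators
open Literature.MathematicalPhysics.QuantumFieldTheory.Balaban1983to89
open Literature.MathematicalPhysics.QuantumFieldTheory.Balaban1983to89.Beta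
open Literature.MathematicalPhysics.QuantumFieldTheory.Balaban1983to89.Beta.BubbleTransfer (c4)
open Literature.MathematicalPhysics.QuantumFieldTheory.Balaban1983to89.B12Normalization (stepBal)
open B12Sec2to5 (l1 l1_nonneg)
open PolarizationSign (AxisReflectionCovariant reflSign)
open ExpKernelCalculus (Site MKer BiLoc comp shiftK tr tadpole bubble Zl Zl_nonneg)
open KernelWard (Bdd divV divW)
open KernelReflection (LegMap refK bondRefl tadpole_smul bubble_smul_left bubble_smul_right)
open StepJetData (biLoc_smul)
open OneStepResolventKernel (Fib LocStencil)
open OneStepKernelFamily (flipK colH)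
open DyadicShell (Pt supNorm)
open LeadingCoefficient (kappaBal)
open AxialProjector (coProj)
open AxialDressing (axDressK)
open SecondOrderResponse (vertex2OfK)
open Summit.QuantumFields.BalabanUV.Beta.GAN24.CombesThomas (sfStep smStep)
open Summit.QuantumFields.BalabanUV.Beta.D1BFx.MomentTransferPeriodicEntry (EKer₂ dressedEntryP)
open Summit.QuantumFields.BalabanUV.Beta.D1BFx.ReducedKernelSandwichLeg (fineHessA fineHessA_apply)
open Summit.QuantumFields.BalabanUV.Beta.D1BFx.DressedTablesLeg (tadpoleTableA_apply bubbleTableA_apply)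
open Summit.QuantumFields.BalabanUV.Beta.D1BFx.PackedKernelSplit (inj blk biLoc_blk)
open Summit.QuantumFields.BalabanUV.Beta.D1BFx.ContactCount (abs_comp_le_of_entryBound abs_comp_le_of_rightLoc abs_tr_le_of_rightLoc
  abs_tadpole_le_of_entryBound abs_bubble_le_of_entryBound)
open Summit.QuantumFields.BalabanUV.Beta.FP.PerfectObjectsT (KPerf TPerfOf)
open Summit.QuantumFields.BalabanUV.Beta.FP.WilsonCubicGerm (cubicGermOf)
open Summit.QuantumFields.BalabanUV.Beta.FP.GhostCubicGerm (cubicGermOfSc)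
open Summit.QuantumFields.BalabanUV.Beta.FP.BubbleGermValue (bfGerm ghostGerm)
open Summit.QuantumFields.BalabanUV.Beta.FP.PerfectPolarization (Pker G0ker PiBF)
open Summit.QuantumFields.BalabanUV.Beta.FP.PerfectPolarizationWard (bdd_Pker)
open Summit.QuantumFields.BalabanUV.Beta.FP.FineHessianGluonCore (fineHessA_gluonCore fineHessA_Pker_eq_ff bdd_smul)
open Summit.QuantumFields.BalabanUV.Beta.FP.FineHessianTransportTable (PiBF_eq_fineHessA)
open Summit.QuantumFields.BalabanUV.Beta.FP.FineSplitJunctionLedgerGen (hasym_PiBF_of_far_nearPieces_gen)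

open Summit.QuantumFields.BalabanUV.Beta.FP.FineHessianNearLedgerCore (abs_ite_le bdd_blk nearSplit_of_slice bounded_seven)
open DecimatedMomentSummable (ConstReproSum LinReproSum)
open Summit.QuantumFields.BalabanUV.Beta.FP.TransportInfinityM (colOf)

variable {Lc : ℕ} [NeZero Lc]

/-- [our object] THE OWNER's (LEDGER) skeleton END `FineHessianNearLedger.hasym_PiBF_vertex2OfK_of_sliceLedger` with `T`, `F`, the END columns and (Kcov) ABSTRACT:
(ASYMP) for the coarse tables `T m` ⟸ {H2V-4 letters, `hKcov`, colour `hn`, (L0)(L1)(LE)(LS) of `colOf (Kp m)`, `hsand`, `hFb`, far letter on `F m`, units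
`(c m, a m, b m)` + bubble weight `κ m`, bounded `R m`, slice stencils∕bi-tables, `hslice` on `F m`, MIX∕ghost splits, `hFN`, the (rem) ledger `hL0`–`hL6`, `hLmix`,
`hLgh`, `hLN`}. -/
theorem hasym_PiBF_of_sliceLedger_gen (hLc : 2 ≤ Lc) (wg wgh : ℝ)
    {V : Fin 4 → Site 4 → MKer 4 (Fib 3)} {W : Fin 4 → Site 4 → Fin 4 → Site 4 → MKer 4 (Fib 3)}
    {v : Fin 4 → Site 4 → MKer 4 Unit} {w : Fin 4 → Site 4 → Fin 4 → Site 4 → MKer 4 Unit} {Cv Cw Cx Cw' Cx' CwL CwL' cQ δ : ℝ} (hδ : 0 < δ)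
    -- admissible-family letters, gluon sector
    (hV : ∀ (μ : Fin 4) (y : Site 4), BiLoc (V μ y) y y Cv δ) (hW : ∀ (μ : Fin 4) (y : Site 4) (ν : Fin 4) (y' : Site 4), BiLoc (W μ y ν y') y y' Cw δ)
    (hcovV : ∀ (μ : Fin 4) (y t : Site 4), V μ (y + t) = shiftK (-t) (V μ y))
    (hcovW : ∀ (μ : Fin 4) (y : Site 4) (ν : Fin 4) (y' t : Site 4), W μ (y + t) ν (y' + t) = shiftK (-t) (W μ y ν y'))
    (X : Site 4 → MKer 4 (Fib 3)) (hX : ∀ y, BiLoc (X y) y y Cx δ)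
    (hW1 : ∀ y, comp (comp Pker (divV V y)) Pker = comp Pker (X y) - comp (X y) Pker)
    (hW2 : ∀ y ν y', divW W y ν y' = comp (X y) (V ν y') - comp (V ν y') (X y))
    (hKcov : AxisReflectionCovariant (flipK (PiBF wg wgh V W v w)))
    (h0V : ∀ (lam α β : Fin 4), ∑' p : Pt × Pt, V lam 0 p.1 p.2 (Sum.inl α) (Sum.inl β) = 0)
    (hgermV : cubicGermOf V = cQ • bfGerm)
    (hWloc : ∀ (μ ν : Fin 4) (z : Pt), BiLoc (W μ 0 ν z) 0 z (CwL * Real.exp (-δ * l1 z)) δ)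
    -- admissible-family letters, ghost sector
    (hv : ∀ (μ : Fin 4) (y : Site 4), BiLoc (v μ y) y y Cv δ) (hw : ∀ (μ : Fin 4) (y : Site 4) (ν : Fin 4) (y' : Site 4), BiLoc (w μ y ν y') y y' Cw' δ)
    (hcovv : ∀ (μ : Fin 4) (y t : Site 4), v μ (y + t) = shiftK (-t) (v μ y))
    (hcovw : ∀ (μ : Fin 4) (y : Site 4) (ν : Fin 4) (y' t : Site 4), w μ (y + t) ν (y' + t) = shiftK (-t) (w μ y ν y'))
    (Xg : Site 4 → MKer 4 Unit) (hXg : ∀ y, BiLoc (Xg y) y y Cx' δ)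
    (hW1g : ∀ y, comp (comp G0ker (divV v y)) G0ker = comp G0ker (Xg y) - comp (Xg y) G0ker)
    (hW2g : ∀ y ν y', divW w y ν y' = comp (Xg y) (v ν y') - comp (v ν y') (Xg y))
    (h0v : ∀ lam : Fin 4, ∑' p : Pt × Pt, v lam 0 p.1 p.2 () () = 0)
    (hgermv : cubicGermOfSc v = ghostGerm)
    (hwloc : ∀ (μ ν : Fin 4) (z : Pt), BiLoc (w μ 0 ν z) 0 z (CwL' * Real.exp (-δ * l1 z)) δ)
    -- the colour weights and the entry
    {N : ℝ} (hn : (40 * wg * (1 / 4 : ℝ) * (c4 * cQ) ^ 2 - wgh * (-(1 / 2 : ℝ)) * c4 ^ 2) / 3 = kappaBal N)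
    {μ ν : Fin 4} (hμν : μ ≠ ν)
    -- THE ABSTRACT COLUMN FAMILY: a packed `Kp m` with the m-UNIFORM END transport letters (L0)(L1)(LE) of `colOf (Kp m)`
    {Kp : ℕ → MKer (3 + 1) (Fib 3)} {δc cc : ℝ} (hδc : 0 < δc) (hcc : 0 ≤ cc)
    (hw0 : ∀ m : ℕ, 1 ≤ m → ∀ κ l, ConstReproSum (Lc ^ m) (colOf (Kp m) κ l)
      (if κ = l then ((((Lc ^ m : ℕ) : ℝ) ^ (4 + 1))⁻¹) else 0))
    (hw1 : ∀ m : ℕ, 1 ≤ m → ∃ Cw' : Fin 4 → Fin 4 → Fin 4 → ℝ, ∀ κ l, LinReproSum (Lc ^ m) (colOf (Kp m) κ l) (Cw' κ l))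
    (hwE : ∀ m : ℕ, 1 ≤ m → ∀ κ l, Summable fun x : Pt => Real.exp (δc / ((Lc ^ m : ℕ) : ℝ) * l1 x) * |colOf (Kp m) κ l x|)
    (hwEb : ∀ m : ℕ, 1 ≤ m → ∀ κ l,
      ∑' x : Pt, Real.exp (δc / ((Lc ^ m : ℕ) : ℝ) * l1 x) * |colOf (Kp m) κ l x| ≤ cc / ((Lc ^ m : ℕ) : ℝ))
    -- the SHARP sup letter (LS) of the columns (for the far piece)
    {Cs κs : ℝ} (hCs : 0 ≤ Cs) (hκs : 0 < κs)
    (hws : ∀ m : ℕ, 1 ≤ m → ∀ (κ l : Fin 4) (x : Pt),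
      |colOf (Kp m) κ l x| ≤ Cs / ((Lc ^ m : ℕ) : ℝ) ^ 5 * Real.exp (-(κs / ((Lc ^ m : ℕ) : ℝ)) * l1 x))
    -- THE ABSTRACT COARSE AND FINE TABLES: the sandwich through the base-`0` columns of `Kp m`; bounded fine entries
    {T : ℕ → Fin 4 → Fin 4 → Pt → ℝ} {F : ℕ → EKer₂ 4}
    (hsand : ∀ m : ℕ, 1 ≤ m → ∀ u : Pt,
      T m μ ν u = dressedEntryP (fun c a => colH (Kp m) (Lc ^ m) a 0 c) (F m) (((Lc ^ m : ℕ) : ℤ) • (-u)) μ ν)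
    (hFb : ∀ m : ℕ, 1 ≤ m → ∀ c e : Fin 4, ∃ A, ∀ s s', |F m c e s s'| ≤ A)
    -- the FAR LETTER of the full fine kernel (m-free shape)
    {CF af : ℝ} (hCF : 0 ≤ CF) (haf : 0 < af)
    (hfar : ∀ m : ℕ, 1 ≤ m → ∀ (c e : Fin 4) (s s' : Pt), Lc ^ m < supNorm (s' - s) →
      |F m c e s s'|
        ≤ ((Lc ^ m : ℕ) : ℝ) ^ 8 * (CF / (supNorm (s' - s) : ℝ) ^ 6 * Real.exp (-(af / ((Lc ^ m : ℕ) : ℝ)) * (supNorm (s' - s) : ℝ))))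
    -- THE DISPLAYED SLICE DATA per `m`: units and bubble weight, remainder leg, slice stencils∕bi-tables, and the slice exchange `hslice`
    {c a b κ : ℕ → ℝ} (hunits₁ : ∀ m : ℕ, 1 ≤ m → (((Lc ^ m : ℕ) : ℝ) ^ 8) * wg = c m * b m)
    (hunits₂ : ∀ m : ℕ, 1 ≤ m → (((Lc ^ m : ℕ) : ℝ) ^ 8) * wg = κ m * (c m ^ 2 * a m ^ 2))
    {R : ℕ → MKer 4 (Fin 4)} (hRb : ∀ m : ℕ, 1 ≤ m → ∃ CR, Bdd (R m) CR)
    {Ssl : ℕ → Fin 4 → Site 4 → MKer 4 (Fin 4)} (hSsl : ∀ m : ℕ, 1 ≤ m → ∃ Cs, ∀ κ u, BiLoc (Ssl m κ u) u u Cs δ)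
    {Wsl : ℕ → Fin 4 → Site 4 → Fin 4 → Site 4 → MKer 4 (Fin 4)} (hWsl : ∀ m : ℕ, 1 ≤ m → ∃ C2, ∀ κ u l u', BiLoc (Wsl m κ u l u') u u' C2 δ)
    {Fmix Fgh FN : ℕ → EKer₂ 4}
    (hslice : ∀ m : ℕ, 1 ≤ m → ∀ (c' e : Fin 4) (s s' : Pt),
      F m c' e s s'
        = ((1 / 2 : ℝ) * tadpole (c m • blk Pker true true + R m) (Wsl m c' s e s')
            - (1 / 2 : ℝ) * κ m * bubble (c m • blk Pker true true + R m) (Ssl m c' s) (Ssl m e s'))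
          + Fmix m c' e s s' + Fgh m c' e s s' + FN m c' e s s')
    -- THE DISPLAYED MIX SPLIT (α2-a PART 2) and GHOST SPLIT (α2-c) into bounded pieces, and the normalisation piece's bound
    {ιM : Type*} (JM : Finset ιM) {Gmix : ιM → ℕ → EKer₂ 4}
    (hmix : ∀ m : ℕ, 1 ≤ m → ∀ (c' e : Fin 4) (s s' : Pt),
      (if supNorm (s' - s) ≤ Lc ^ m then Fmix m c' e s s' else 0) = ∑ k ∈ JM, Gmix k m c' e s s')
    (hGmix : ∀ k ∈ JM, ∀ m : ℕ, 1 ≤ m → ∀ c' e : Fin 4, ∃ A, ∀ s s', |Gmix k m c' e s s'| ≤ A)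
    {ιG : Type*} (JG : Finset ιG) {Ggh : ιG → ℕ → EKer₂ 4}
    (hgh : ∀ m : ℕ, 1 ≤ m → ∀ (c' e : Fin 4) (s s' : Pt),
      (if supNorm (s' - s) ≤ Lc ^ m then Fgh m c' e s s' + ((Lc ^ m : ℕ) : ℝ) ^ 8 * wgh * fineHessA G0ker v w c' e s s' else 0)
        = ∑ k ∈ JG, Ggh k m c' e s s')
    (hGgh : ∀ k ∈ JG, ∀ m : ℕ, 1 ≤ m → ∀ c' e : Fin 4, ∃ A, ∀ s s', |Ggh k m c' e s s'| ≤ A)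
    (hFN : ∀ m : ℕ, 1 ≤ m → ∀ c' e : Fin 4, ∃ A, ∀ s s', |FN m c' e s s'| ≤ A)
    -- THE (rem) LEDGER: one number per named piece
    {B7 : Fin 7 → ℝ} {Bmix : ιM → ℝ} {Bgh : ιG → ℝ} {BN : ℝ}
    (hL0 : ∀ m : ℕ, 1 ≤ m → ∀ S' : Finset Pt, ∑ u ∈ S', (supNorm u : ℝ) ^ 2 *
      |dressedEntryP (fun c'' a' => colH (Kp m) (Lc ^ m) a' 0 c'')
        (fun c' e s s' => if supNorm (s' - s) ≤ Lc ^ m then (1 / 2 : ℝ) * tadpole (R m) (Wsl m c' s e s') else 0)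
        (((Lc ^ m : ℕ) : ℤ) • (-u)) μ ν| ≤ B7 0)
    (hL1 : ∀ m : ℕ, 1 ≤ m → ∀ S' : Finset Pt, ∑ u ∈ S', (supNorm u : ℝ) ^ 2 *
      |dressedEntryP (fun c'' a' => colH (Kp m) (Lc ^ m) a' 0 c'')
        (fun c' e s s' => if supNorm (s' - s) ≤ Lc ^ m then
          -((1 / 2 : ℝ) * κ m) * tr (comp (comp (c m • blk Pker true true) (Ssl m c' s)) (comp (R m) (Ssl m e s'))) else 0)
        (((Lc ^ m : ℕ) : ℤ) • (-u)) μ ν| ≤ B7 1)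
    (hL2 : ∀ m : ℕ, 1 ≤ m → ∀ S' : Finset Pt, ∑ u ∈ S', (supNorm u : ℝ) ^ 2 *
      |dressedEntryP (fun c'' a' => colH (Kp m) (Lc ^ m) a' 0 c'')
        (fun c' e s s' => if supNorm (s' - s) ≤ Lc ^ m then
          -((1 / 2 : ℝ) * κ m) * tr (comp (comp (R m) (Ssl m c' s)) (comp (c m • blk Pker true true) (Ssl m e s'))) else 0)
        (((Lc ^ m : ℕ) : ℤ) • (-u)) μ ν| ≤ B7 2)
    (hL3 : ∀ m : ℕ, 1 ≤ m → ∀ S' : Finset Pt, ∑ u ∈ S', (supNorm u : ℝ) ^ 2 *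
      |dressedEntryP (fun c'' a' => colH (Kp m) (Lc ^ m) a' 0 c'')
        (fun c' e s s' => if supNorm (s' - s) ≤ Lc ^ m then -((1 / 2 : ℝ) * κ m) * bubble (R m) (Ssl m c' s) (Ssl m e s') else 0)
        (((Lc ^ m : ℕ) : ℤ) • (-u)) μ ν| ≤ B7 3)
    (hL4 : ∀ m : ℕ, 1 ≤ m → ∀ S' : Finset Pt, ∑ u ∈ S', (supNorm u : ℝ) ^ 2 *
      |dressedEntryP (fun c'' a' => colH (Kp m) (Lc ^ m) a' 0 c'')
        (fun c' e s s' => if supNorm (s' - s) ≤ Lc ^ m then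
          (1 / 2 : ℝ) * tadpole (c m • blk Pker true true) (Wsl m c' s e s' - b m • blk (W c' s e s') true true) else 0)
        (((Lc ^ m : ℕ) : ℤ) • (-u)) μ ν| ≤ B7 4)
    (hL5 : ∀ m : ℕ, 1 ≤ m → ∀ S' : Finset Pt, ∑ u ∈ S', (supNorm u : ℝ) ^ 2 *
      |dressedEntryP (fun c'' a' => colH (Kp m) (Lc ^ m) a' 0 c'')
        (fun c' e s s' => if supNorm (s' - s) ≤ Lc ^ m then
          -((1 / 2 : ℝ) * κ m) * bubble (c m • blk Pker true true) (Ssl m c' s - a m • blk (V c' s) true true) (Ssl m e s') else 0)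
        (((Lc ^ m : ℕ) : ℤ) • (-u)) μ ν| ≤ B7 5)
    (hL6 : ∀ m : ℕ, 1 ≤ m → ∀ S' : Finset Pt, ∑ u ∈ S', (supNorm u : ℝ) ^ 2 *
      |dressedEntryP (fun c'' a' => colH (Kp m) (Lc ^ m) a' 0 c'')
        (fun c' e s s' => if supNorm (s' - s) ≤ Lc ^ m then
          -((1 / 2 : ℝ) * κ m) * bubble (c m • blk Pker true true) (a m • blk (V c' s) true true) (Ssl m e s' - a m • blk (V e s') true true) else 0)
        (((Lc ^ m : ℕ) : ℤ) • (-u)) μ ν| ≤ B7 6)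
    (hLmix : ∀ k ∈ JM, ∀ m : ℕ, 1 ≤ m → ∀ S' : Finset Pt, ∑ u ∈ S', (supNorm u : ℝ) ^ 2 *
      |dressedEntryP (fun c'' a' => colH (Kp m) (Lc ^ m) a' 0 c'') (Gmix k m)
        (((Lc ^ m : ℕ) : ℤ) • (-u)) μ ν| ≤ Bmix k)
    (hLgh : ∀ k ∈ JG, ∀ m : ℕ, 1 ≤ m → ∀ S' : Finset Pt, ∑ u ∈ S', (supNorm u : ℝ) ^ 2 *
      |dressedEntryP (fun c'' a' => colH (Kp m) (Lc ^ m) a' 0 c'') (Ggh k m)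
        (((Lc ^ m : ℕ) : ℤ) • (-u)) μ ν| ≤ Bgh k)
    (hLN : ∀ m : ℕ, 1 ≤ m → ∀ S' : Finset Pt, ∑ u ∈ S', (supNorm u : ℝ) ^ 2 *
      |dressedEntryP (fun c'' a' => colH (Kp m) (Lc ^ m) a' 0 c'')
        (fun c' e s s' => if supNorm (s' - s) ≤ Lc ^ m then FN m c' e s s' else 0)
        (((Lc ^ m : ℕ) : ℤ) • (-u)) μ ν| ≤ BN) :
    ∃ U : ℝ, 0 ≤ U ∧ ∃ Cg : ℝ, ∀ m : ℕ, 1 ≤ m →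
      |B12Beta.secondMoment (T m) μ ν - (m : ℝ) * stepBal N Lc|
        ≤ (U + (∑ i : Fin 7, B7 i + (∑ k ∈ JM, Bmix k + (∑ k ∈ JG, Bgh k + BN)))) + Cg := by
  classical
  -- the comparison leg and data on the ff fibre
  have hPb : Bdd (blk Pker true true) PerfectPropagatorLegData.A0P := bdd_blk bdd_Pker true true
  have hVtt : ∀ κ y, BiLoc (blk (V κ y) true true) y y Cv δ := fun κ y => biLoc_blk (hV κ y) true true
  have hWtt : ∀ κ y l y', BiLoc (blk (W κ y l y') true true) y y' Cw δ := fun κ y l y' => biLoc_blk (hW κ y l y') true true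
  -- the comparison identity at the road's objects (PART 0 + PART 2 §1)
  have hPi : ∀ (c' e : Fin 4) (s s' : Pt), PiBF wg wgh V W v w c' e (s' - s)
      = wg * fineHessA (blk Pker true true) (fun κ y => blk (V κ y) true true) (fun κ y l y' => blk (W κ y l y') true true) c' e s s'
        - wgh * fineHessA G0ker v w c' e s s' := fun c' e s s' => by
    rw [PiBF_eq_fineHessA wg wgh hcovV hcovW hcovv hcovw, fineHessA_Pker_eq_ff]
  -- the named piece family and its ledger
  let G : (Fin 7 ⊕ (ιM ⊕ (ιG ⊕ Unit))) → ℕ → EKer₂ 4 := fun j m =>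
    Sum.elim
      (![(fun c' e s s' => if supNorm (s' - s) ≤ Lc ^ m then (1 / 2 : ℝ) * tadpole (R m) (Wsl m c' s e s') else 0 : EKer₂ 4),
         (fun c' e s s' => if supNorm (s' - s) ≤ Lc ^ m then
            -((1 / 2 : ℝ) * κ m) * tr (comp (comp (c m • blk Pker true true) (Ssl m c' s)) (comp (R m) (Ssl m e s'))) else 0),
         (fun c' e s s' => if supNorm (s' - s) ≤ Lc ^ m then
            -((1 / 2 : ℝ) * κ m) * tr (comp (comp (R m) (Ssl m c' s)) (comp (c m • blk Pker true true) (Ssl m e s'))) else 0),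
         (fun c' e s s' => if supNorm (s' - s) ≤ Lc ^ m then -((1 / 2 : ℝ) * κ m) * bubble (R m) (Ssl m c' s) (Ssl m e s') else 0),
         (fun c' e s s' => if supNorm (s' - s) ≤ Lc ^ m then
            (1 / 2 : ℝ) * tadpole (c m • blk Pker true true) (Wsl m c' s e s' - b m • blk (W c' s e s') true true) else 0),
         (fun c' e s s' => if supNorm (s' - s) ≤ Lc ^ m then
            -((1 / 2 : ℝ) * κ m) * bubble (c m • blk Pker true true) (Ssl m c' s - a m • blk (V c' s) true true) (Ssl m e s') else 0),
         (fun c' e s s' => if supNorm (s' - s) ≤ Lc ^ m then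
            -((1 / 2 : ℝ) * κ m) * bubble (c m • blk Pker true true) (a m • blk (V c' s) true true) (Ssl m e s' - a m • blk (V e s') true true) else 0)])
      (Sum.elim (fun k => Gmix k m) (Sum.elim (fun k => Ggh k m)
        (fun _ c' e s s' => if supNorm (s' - s) ≤ Lc ^ m then FN m c' e s s' else 0))) j
  let B : (Fin 7 ⊕ (ιM ⊕ (ιG ⊕ Unit))) → ℝ := Sum.elim B7 (Sum.elim Bmix (Sum.elim Bgh fun _ => BN))
  let J : Finset (Fin 7 ⊕ (ιM ⊕ (ιG ⊕ Unit))) := (Finset.univ : Finset (Fin 7)).disjSum (JM.disjSum (JG.disjSum ({()} : Finset Unit)))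
  have hsumB : ∑ j ∈ J, B j = ∑ i : Fin 7, B7 i + (∑ k ∈ JM, Bmix k + (∑ k ∈ JG, Bgh k + BN)) := by
    simp only [J, B, Finset.sum_disjSum, Sum.elim_inl, Sum.elim_inr, Finset.sum_singleton]
  -- the near split
  have hnearSplit : ∀ m : ℕ, 1 ≤ m → ∀ (c' e : Fin 4) (s s' : Pt),
      (if supNorm (s' - s) ≤ Lc ^ m then
          F m c' e s s'
            - ((Lc ^ m : ℕ) : ℝ) ^ 8 * PiBF wg wgh V W v w c' e (s' - s) else 0) = ∑ j ∈ J, G j m c' e s s' := by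
    intro m hm c' e s s'
    obtain ⟨CR, hR⟩ := hRb m hm
    obtain ⟨Cs, hSs⟩ := hSsl m hm
    obtain ⟨C2, hW2⟩ := hWsl m hm
    rw [nearSplit_of_slice hPb hR (c m) (a m) (b m) (κ m) (((Lc ^ m : ℕ) : ℝ) ^ 8) wg wgh (hunits₁ m hm) (hunits₂ m hm) (Lc ^ m) hSs hVtt hW2 hWtt hδ
      (Ftab := fun c' e s s' => F m c' e s s')
      (hslice m hm) hPi JM (hmix m hm) JG (Ggh := fun k => Ggh k m) (by
        intro c' e s s'
        have h := hgh m hm c' e s s'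
        simpa [mul_assoc] using h) c' e s s']
  -- boundedness of the named pieces
  have hGb : ∀ j ∈ J, ∀ m : ℕ, 1 ≤ m → ∀ c' e : Fin 4, ∃ A, ∀ s s', |G j m c' e s s'| ≤ A := by
    rintro (j | k | k | ⟨⟩) hj m hm c' e
    · obtain ⟨CR, hR⟩ := hRb m hm
      obtain ⟨Cs, hSs⟩ := hSsl m hm
      obtain ⟨C2, hW2⟩ := hWsl m hm
      obtain ⟨A, h0, h1, h2, h3, h4, h5, h6⟩ :=
        bounded_seven hPb hR (c m) (a m) (b m) (κ m) (Lc ^ m) hSs hVtt hW2 hWtt hδ c' e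
      refine ⟨A, fun s s' => ?_⟩
      fin_cases j
      · exact h0 s s'
      · exact h1 s s'
      · exact h2 s s'
      · exact h3 s s'
      · exact h4 s s'
      · exact h5 s s'
      · exact h6 s s'
    · have hk : k ∈ JM := by simpa [J, Finset.mem_disjSum] using hj
      exact hGmix k hk m hm c' e
    · have hk : k ∈ JG := by simpa [J, Finset.mem_disjSum] using hj
      exact hGgh k hk m hm c' e
    · obtain ⟨A, hA⟩ := hFN m hm c' e
      exact ⟨A, fun s s' => (abs_ite_le _ _).trans (hA s s')⟩
  -- the ledger of the named pieces
  have hledger : ∀ j ∈ J, ∀ m : ℕ, 1 ≤ m → ∀ S' : Finset Pt, ∑ u ∈ S', (supNorm u : ℝ) ^ 2 *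
      |dressedEntryP (fun c'' a' => colH (Kp m) (Lc ^ m) a' 0 c'') (G j m)
        (((Lc ^ m : ℕ) : ℤ) • (-u)) μ ν| ≤ B j := by
    rintro (j | k | k | ⟨⟩) hj m hm S'
    · fin_cases j
      · exact hL0 m hm S'
      · exact hL1 m hm S'
      · exact hL2 m hm S'
      · exact hL3 m hm S'
      · exact hL4 m hm S'
      · exact hL5 m hm S'
      · exact hL6 m hm S'
    · have hk : k ∈ JM := by simpa [J, Finset.mem_disjSum] using hj
      exact hLmix k hk m hm S'
    · have hk : k ∈ JG := by simpa [J, Finset.mem_disjSum] using hj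
      exact hLgh k hk m hm S'
    · exact hLN m hm S'
  obtain ⟨U, hU, Cg, hEnd⟩ := hasym_PiBF_of_far_nearPieces_gen hLc wg wgh hδ hV hW hcovV hcovW X hX hW1 hW2 hKcov h0V hgermV hWloc
    hv hw hcovv hcovw Xg hXg hW1g hW2g h0v hgermv hwloc hn hμν hδc hcc hw0 hw1 hwE hwEb hCs hκs hws hsand hFb hCF haf hfar J hnearSplit hGb hledger
  refine ⟨U, hU, Cg, fun m hm => ?_⟩
  rw [← hsumB]
  exact hEnd m hm

end Summit.QuantumFields.BalabanUV.Beta.FP.FineHessianNearLedgerGen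

end
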